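import Literature.RingTheory.MvPowerSeries.HasseDerivFrobenius
import Mathlib.Order.Preorder.Finite
import HarnessLib

/-!
# Residue classes of exponents modulo `q`, and divided (Hasse) derivatives on them (characteristic `p`)

Topic: `Literature/RingTheory/MvPowerSeries`. A power series `f ∈ A⟦X_τ⟧` is SUPPORTED ON THE RESIDUE CLASS
of `r ∈ ℕ^τ` modulo `q` (`IsSupportedOnResidue q r f`) when every exponent `m` carrying a non-zero
coefficient satisfies `m_s ≡ r_s (mod q)` for all `s`; for `r = 0` this is `IsSupportedOnMultiples q`
(`FrobeniusPowerBasis.lean`: the subring `A⟦X^q⟧`). Residue classes add under products, are preserved by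
`Δ_B = hasseDeriv B` when `q ∣ B`, and are shifted by `−K` under `Δ_K` in general.

Main statements (prime characteristic `p`, `q = p^e`, `τ` finite):
* `choose_add_mul_modEq` — one Lucas step for two-level digit expansions: for `a, α < p`,
  `C(a + p·b, α + p·β) ≡ C(a, α)·C(b, β) (mod p)`; `choose_add_pow_mul_add_pow_mul_modEq` — the
  `q`-block form `C(A + q·c, A′ + q·c′) ≡ C(A, A′)·C(c, c′) (mod p)` for `A, A′ < q`.
* `coeff_hasseDeriv_of_isSupportedOnResidue` — for `f` supported on the residue class of `r` with
  `r_s, K_s < q`: `coeff_β (Δ_K f) = (∏_s C(r_s, K_s)) · coeff_{K+β} f` (Lucas periodicity); hence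
  `Δ_K f = 0` when `p ∣ ∏_s C(r_s, K_s)` (`hasseDeriv_eq_zero_of_isSupportedOnResidue`) and `Δ_K f` is the
  plain shift `β ↦ f_{K+β}` when the product is `1` (`coeff_hasseDeriv_of_isSupportedOnResidue_self`:
  the case `K = r`).
* Two-level digits: for `a, α < p` coordinatewise and `¬ (α ≤ a ∧ β ≤ b)`, the multi-index binomial
  `∏_s C(a_s + p b_s, α_s + p β_s)` vanishes in `A` (`natCast_prod_choose_digit_eq_zero`); so
  `Δ_{α + p β}` KILLS every series supported on the residue class of `a + p b` unless `α ≤ a` and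
  `β ≤ b` (`hasseDeriv_digit_eq_zero_of_isSupportedOnResidue`), and on the class of `α + p β` itself it
  is the shift by `α + p β` (`coeff_hasseDeriv_digit_self`).
* Monomials of finite unit-monomial sums `Φ = Σ_{t ∈ s} u_t · X^{θ_t}` with `u_t ∈ A⟦X^q⟧`: every
  exponent in the support of `Φ` is congruent mod `q` to some `θ_t` with `u_t ≠ 0`
  (`exists_modEq_of_coeff_sum_mul_monomial_ne_zero`); conversely, if the `θ_t` are distinct on `s` and
  the non-zero `u_t` have non-zero constant coefficient, then for every `t₀ ∈ s` with `u_{t₀} ≠ 0` the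
  series `Φ` HAS a non-zero coefficient at an exponent congruent to `θ_{t₀}` mod `q`
  (`exists_coeff_ne_zero_modEq_of_sum_mul_monomial`; minimal-exponent argument).

## Sources (read on the page) and what is proved here

C. Abad, *p-bases and differential operators on varieties defined over a non-perfect field*, J. Algebra
523 (2019) = arXiv:1801.08458 [Abad2019pBases], §6 p.13 (held text p0013), Lemma 6.2 (Giraud: a
differential operator of order `n` is `k[A^{p^e}]`-linear for `p^e > n`) and «Tay^β(X^α) = binom(α,β)
X^{α−β}»; the arithmetic engine is Lucas' theorem as in Mathlib (`Choose.choose_modEq_choose_mod_mul_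
choose_div_nat`, file `Mathlib/Data/Nat/Choose/Lucas.lean`) and its periodicity corollary
`choose_add_pow_mul_modEq` of `HasseDerivFrobenius.lean`. H. Matsumura, *Commutative Ring Theory*
[Matsumura1987] §30 proof of Thm. 30.9 p.243–244 for the `q`-adic decomposition language
(`FrobeniusPowerBasis.lean`). WHAT THIS FILE PROVES: elementary bookkeeping of exponent residues for
the tree's `hasseDeriv` — every statement is a direct coefficient computation; no new mathematics beyond
Lucas' theorem. NOT here: anything about specific standard expressions (that is the business of the
files which import this one).
-/

noncomputable section

open _root_.MvPowerSeries

namespace Literature.RingTheory.MvPowerSeries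

universe u v

variable {τ : Type v} {A : Type u} [CommRing A]

/-! ## Lucas steps for digit expansions -/

/-- **One Lucas step for two-level digits**: for a prime `p` and `a, α < p`,
`C(a + p·b, α + p·β) ≡ C(a, α) · C(b, β) (mod p)`.
[cite: Abad2019pBases, Lemma 6.2 (arithmetic behind p^e-linearity; Lucas)] -/
theorem choose_add_mul_modEq {p : ℕ} [hp : Fact p.Prime] {a α : ℕ} (ha : a < p) (hα : α < p)
    (b β : ℕ) : (a + p * b).choose (α + p * β) ≡ a.choose α * b.choose β [MOD p] := by
  have hp0 : 0 < p := hp.out.pos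
  have h := Choose.choose_modEq_choose_mod_mul_choose_div_nat (n := a + p * b) (k := α + p * β)
    (p := p)
  rwa [Nat.add_mul_mod_self_left, Nat.add_mul_mod_self_left, Nat.mod_eq_of_lt ha,
    Nat.mod_eq_of_lt hα, Nat.add_mul_div_left _ _ hp0, Nat.add_mul_div_left _ _ hp0,
    Nat.div_eq_of_lt ha, Nat.div_eq_of_lt hα, zero_add, zero_add] at h

/-- **`q`-block Lucas** (`q = p^e`): for `A, A′ < p^e`,
`C(A + p^e·c, A′ + p^e·c′) ≡ C(A, A′) · C(c, c′) (mod p)` (iterate the one-step Lucas congruence `e`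
times). [cite: Abad2019pBases, Lemma 6.2 (arithmetic behind p^e-linearity; Lucas)] -/
theorem choose_add_pow_mul_add_pow_mul_modEq {p : ℕ} [hp : Fact p.Prime] :
    ∀ (e : ℕ) {A A' : ℕ} (c c' : ℕ), A < p ^ e → A' < p ^ e →
      (A + p ^ e * c).choose (A' + p ^ e * c') ≡ A.choose A' * c.choose c' [MOD p]
  | 0, A, A', c, c', hA, hA' => by
    have hA0 : A = 0 := by simpa using hA
    have hA0' : A' = 0 := by simpa using hA'
    subst hA0 hA0'
    simp [Nat.ModEq.refl]
  | e + 1, A, A', c, c', hA, hA' => by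
    have hp0 : 0 < p := hp.out.pos
    have h1 := Choose.choose_modEq_choose_mod_mul_choose_div_nat (n := A + p ^ (e + 1) * c)
      (k := A' + p ^ (e + 1) * c') (p := p)
    have hmod : ∀ B d : ℕ, (B + p ^ (e + 1) * d) % p = B % p := fun B d => by
      rw [pow_succ', mul_assoc, Nat.add_mul_mod_self_left]
    have hdiv : ∀ B d : ℕ, (B + p ^ (e + 1) * d) / p = B / p + p ^ e * d := fun B d => by
      rw [pow_succ', mul_assoc, Nat.add_mul_div_left _ _ hp0]
    have hlt : ∀ {B : ℕ}, B < p ^ (e + 1) → B / p < p ^ e := fun {B} hB => by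
      rw [Nat.div_lt_iff_lt_mul hp0]
      simpa [pow_succ] using hB
    rw [hmod, hmod, hdiv, hdiv] at h1
    have ih := choose_add_pow_mul_add_pow_mul_modEq e c c' (hlt hA) (hlt hA')
    have h2 := Choose.choose_modEq_choose_mod_mul_choose_div_nat (n := A) (k := A') (p := p)
    calc (A + p ^ (e + 1) * c).choose (A' + p ^ (e + 1) * c')
        ≡ (A % p).choose (A' % p) * ((A / p).choose (A' / p) * c.choose c') [MOD p] :=
          h1.trans (ih.mul_left _)
      _ = (A % p).choose (A' % p) * (A / p).choose (A' / p) * c.choose c' := by ring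
      _ ≡ A.choose A' * c.choose c' [MOD p] := h2.symm.mul_right _

/-- Digit bound: `a < p` and `b < p^{e−1}` with `0 < e` give `a + p·b < p^e`.
[cite: Abad2019pBases, Lemma 6.2 (arithmetic behind p^e-linearity; Lucas)] -/
theorem digit_add_mul_lt_pow {p a b e : ℕ} (ha : a < p) (hb : b < p ^ (e - 1)) (he : 0 < e) :
    a + p * b < p ^ e := by
  obtain ⟨e, rfl⟩ := Nat.exists_eq_add_of_le he
  simp only [Nat.add_sub_cancel_left] at hb
  have h1 : a + p * b < p + p * b := by omega
  have h2 : p + p * b = p * (b + 1) := by ring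
  calc a + p * b < p * (b + 1) := by rw [← h2]; exact h1
    _ ≤ p * p ^ e := Nat.mul_le_mul_left _ hb
    _ = p ^ (1 + e) := by rw [pow_add, pow_one]

section Digits

variable (p : ℕ) [hp : Fact p.Prime] [CharP A p] [Fintype τ]

/-- **Two-level digits, vanishing**: for `a, α < p` coordinatewise, if NOT (`α ≤ a` and `β ≤ b`) then the
multi-index binomial `∏_s C(a_s + p b_s, α_s + p β_s)` is `0` in `A` (at a bad coordinate `s` the factor is
`≡ C(a_s, α_s) C(b_s, β_s) = 0 (mod p)`). [cite: Abad2019pBases, Lemma 6.2 (arithmetic behind p^e-linearity; Lucas)] -/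
theorem natCast_prod_choose_digit_eq_zero {a b α β : τ →₀ ℕ} (ha : ∀ s, a s < p) (hα : ∀ s, α s < p)
    (h : ¬ (α ≤ a ∧ β ≤ b)) :
    ((∏ s, (a s + p * b s).choose (α s + p * β s) : ℕ) : A) = 0 := by
  obtain ⟨s, hs⟩ : ∃ s, a s < α s ∨ b s < β s := by
    by_contra hcon
    push Not at hcon
    exact h ⟨fun s => (hcon s).1, fun s => (hcon s).2⟩
  have hdvd : p ∣ (a s + p * b s).choose (α s + p * β s) := by
    have hmod := choose_add_mul_modEq (ha s) (hα s) (b s) (β s)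
    have h0 : (a s).choose (α s) * (b s).choose (β s) = 0 := by
      rcases hs with hs | hs
      · rw [Nat.choose_eq_zero_of_lt hs, zero_mul]
      · rw [Nat.choose_eq_zero_of_lt hs, mul_zero]
    rw [h0] at hmod
    exact Nat.modEq_zero_iff_dvd.mp hmod
  rw [Nat.cast_prod]
  exact Finset.prod_eq_zero (Finset.mem_univ s) ((CharP.cast_eq_zero_iff A p _).mpr hdvd)

omit hp [CharP A p] in
/-- **Two-level digits, diagonal**: `∏_s C(a_s + p b_s, a_s + p b_s) = 1`.
[cite: Abad2019pBases, Lemma 6.2 (arithmetic behind p^e-linearity; Lucas)] -/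
theorem prod_choose_digit_self (a b : τ →₀ ℕ) :
    (∏ s, (a s + p * b s).choose (a s + p * b s)) = 1 := by
  simp

end Digits

/-! ## Series supported on one residue class of exponents modulo `q` -/

/-- `f` is **supported on the residue class of `r` modulo `q`**: every exponent `m` with `coeff m f ≠ 0`
satisfies `m_s ≡ r_s (mod q)` for every index `s`. For `r = 0` this is `IsSupportedOnMultiples q f`
(`isSupportedOnResidue_zero_iff`). [cite: Matsumura1987, §30 proof of Thm. 30.9 p. 243 (q-adic monomial decomposition)] -/
def IsSupportedOnResidue (q : ℕ) (r : τ →₀ ℕ) (f : MvPowerSeries τ A) : Prop :=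
  ∀ m : τ →₀ ℕ, coeff m f ≠ 0 → ∀ s, m s ≡ r s [MOD q]

namespace IsSupportedOnResidue

variable {q : ℕ} {r r' : τ →₀ ℕ} {f g : MvPowerSeries τ A}

/-- Coefficients off the residue class vanish. [cite: Matsumura1987, §30 proof of Thm. 30.9 p. 243 (q-adic monomial decomposition)] -/
theorem coeff_eq_zero (hf : IsSupportedOnResidue q r f) {m : τ →₀ ℕ} (hm : ∃ s, ¬ m s ≡ r s [MOD q]) :
    coeff m f = 0 := by
  by_contra h
  obtain ⟨s, hs⟩ := hm
  exact hs (hf m h s)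

/-- Transport along a congruent residue vector. [cite: Matsumura1987, §30 proof of Thm. 30.9 p. 243 (q-adic monomial decomposition)] -/
theorem of_modEq (hf : IsSupportedOnResidue q r f) (h : ∀ s, r s ≡ r' s [MOD q]) :
    IsSupportedOnResidue q r' f :=
  fun m hm s => (hf m hm s).trans (h s)

/-- Closure under addition. [cite: Matsumura1987, §30 proof of Thm. 30.9 p. 243 (q-adic monomial decomposition)] -/
theorem add (hf : IsSupportedOnResidue q r f) (hg : IsSupportedOnResidue q r g) :
    IsSupportedOnResidue q r (f + g) := by
  intro m hm s
  rw [map_add] at hm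
  by_cases h : coeff m f = 0
  · rw [h, zero_add] at hm
    exact hg m hm s
  · exact hf m h s

/-- Closure under negation. [cite: Matsumura1987, §30 proof of Thm. 30.9 p. 243 (q-adic monomial decomposition)] -/
theorem neg (hf : IsSupportedOnResidue q r f) : IsSupportedOnResidue q r (-f) := by
  intro m hm s
  rw [map_neg, neg_ne_zero] at hm
  exact hf m hm s

/-- Closure under subtraction. [cite: Matsumura1987, §30 proof of Thm. 30.9 p. 243 (q-adic monomial decomposition)] -/
theorem sub (hf : IsSupportedOnResidue q r f) (hg : IsSupportedOnResidue q r g) :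
    IsSupportedOnResidue q r (f - g) := by
  rw [sub_eq_add_neg]
  exact hf.add hg.neg

/-- Closure under left multiplication by a constant. [cite: Matsumura1987, §30 proof of Thm. 30.9 p. 243 (q-adic monomial decomposition)] -/
theorem const_mul (hf : IsSupportedOnResidue q r f) (c : A) : IsSupportedOnResidue q r (C c * f) := by
  intro m hm s
  rw [coeff_C_mul] at hm
  exact hf m (right_ne_zero_of_mul hm) s

/-- **Residues add under products.** [cite: Matsumura1987, §30 proof of Thm. 30.9 p. 243 (q-adic monomial decomposition)] -/
theorem mul (hf : IsSupportedOnResidue q r f) (hg : IsSupportedOnResidue q r' g) :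
    IsSupportedOnResidue q (r + r') (f * g) := by
  classical
  intro m hm s
  rw [coeff_mul] at hm
  obtain ⟨x, hx, hx0⟩ := Finset.exists_ne_zero_of_sum_ne_zero hm
  have hxm : x.1 + x.2 = m := Finset.HasAntidiagonal.mem_antidiagonal.mp hx
  have h1 : coeff x.1 f ≠ 0 := left_ne_zero_of_mul hx0
  have h2 : coeff x.2 g ≠ 0 := right_ne_zero_of_mul hx0
  rw [← hxm, Finsupp.add_apply, Finsupp.add_apply]
  exact (hf x.1 h1 s).add (hg x.2 h2 s)

end IsSupportedOnResidue

/-- The zero series is supported on every residue class. [cite: Matsumura1987, §30 proof of Thm. 30.9 p. 243 (q-adic monomial decomposition)] -/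
theorem isSupportedOnResidue_zero_series (q : ℕ) (r : τ →₀ ℕ) :
    IsSupportedOnResidue q r (0 : MvPowerSeries τ A) :=
  fun _ hm => absurd (map_zero _) hm

/-- Finite sums of series supported on one residue class. [cite: Matsumura1987, §30 proof of Thm. 30.9 p. 243 (q-adic monomial decomposition)] -/
theorem isSupportedOnResidue_sum {q : ℕ} {r : τ →₀ ℕ} {ι : Type*} (s : Finset ι)
    (f : ι → MvPowerSeries τ A) (hf : ∀ i ∈ s, IsSupportedOnResidue q r (f i)) :
    IsSupportedOnResidue q r (∑ i ∈ s, f i) := by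
  classical
  induction s using Finset.induction_on with
  | empty => rw [Finset.sum_empty]; exact isSupportedOnResidue_zero_series q r
  | insert i s hi ih =>
    rw [Finset.sum_insert hi]
    exact (hf i (Finset.mem_insert_self i s)).add
      (ih fun j hj => hf j (Finset.mem_insert_of_mem hj))

/-- A monomial `c X^θ` is supported on the residue class of `θ`. [cite: Matsumura1987, §30 proof of Thm. 30.9 p. 243 (q-adic monomial decomposition)] -/
theorem isSupportedOnResidue_monomial [DecidableEq τ] (q : ℕ) (θ : τ →₀ ℕ) (c : A) :
    IsSupportedOnResidue q θ (monomial θ c) := by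
  intro m hm s
  rw [coeff_monomial] at hm
  by_cases h : m = θ
  · rw [h]
  · rw [if_neg h] at hm
    exact absurd rfl hm

/-- Residue class `0` = supported on multiples of `q`. [cite: Matsumura1987, §30 proof of Thm. 30.9 p. 243 (q-adic monomial decomposition)] -/
theorem isSupportedOnResidue_zero_iff {q : ℕ} {f : MvPowerSeries τ A} :
    IsSupportedOnResidue q 0 f ↔ IsSupportedOnMultiples q f := by
  constructor
  · intro hf m ⟨s, hs⟩
    by_contra h
    exact hs (Nat.modEq_zero_iff_dvd.mp (hf m h s))
  · intro hf m hm s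
    rw [Finsupp.coe_zero, Pi.zero_apply]
    refine Nat.modEq_zero_iff_dvd.mpr ?_
    by_contra hs
    exact hm (hf m ⟨s, hs⟩)

/-- A unit-monomial `u · c X^θ` with `u ∈ A⟦X^q⟧` is supported on the residue class of `θ`.
[cite: Matsumura1987, §30 proof of Thm. 30.9 p. 243 (q-adic monomial decomposition)] -/
theorem IsSupportedOnMultiples.isSupportedOnResidue_mul_monomial [DecidableEq τ] {q : ℕ}
    {u : MvPowerSeries τ A} (hu : IsSupportedOnMultiples q u) (θ : τ →₀ ℕ) (c : A) :
    IsSupportedOnResidue q θ (u * monomial θ c) := by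
  have h := (isSupportedOnResidue_zero_iff.mpr hu).mul (isSupportedOnResidue_monomial q θ c)
  rwa [zero_add] at h

/-- If `q′ ∣ q`, support on a residue class mod `q` implies support on the class mod `q′`.
[cite: Matsumura1987, §30 proof of Thm. 30.9 p. 243 (q-adic monomial decomposition)] -/
theorem IsSupportedOnResidue.of_dvd {q q' : ℕ} {r : τ →₀ ℕ} {f : MvPowerSeries τ A}
    (hf : IsSupportedOnResidue q r f) (h : q' ∣ q) : IsSupportedOnResidue q' r f :=
  fun m hm s => Nat.ModEq.of_dvd h (hf m hm s)

/-- Likewise `A⟦X^q⟧ ⊆ A⟦X^{q′}⟧` for `q′ ∣ q`. [cite: Matsumura1987, §30 proof of Thm. 30.9 p. 243 (q-adic monomial decomposition)] -/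
theorem IsSupportedOnMultiples.of_dvd {q q' : ℕ} {f : MvPowerSeries τ A}
    (hf : IsSupportedOnMultiples q f) (h : q' ∣ q) : IsSupportedOnMultiples q' f :=
  isSupportedOnResidue_zero_iff.mp ((isSupportedOnResidue_zero_iff.mpr hf).of_dvd h)

/-! ### Exponents occurring in finite unit-monomial sums -/

/-- Every exponent in the support of `Σ_{t ∈ s} f_t`, with `f_t` supported on the residue class of `θ_t`,
is congruent mod `q` to `θ_t` for some `t ∈ s` with `f_t ≠ 0`.
[cite: Matsumura1987, §30 proof of Thm. 30.9 p. 243 (q-adic monomial decomposition)] -/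
theorem exists_modEq_of_coeff_sum_ne_zero {q : ℕ} {ι : Type*} (s : Finset ι) (f : ι → MvPowerSeries τ A)
    (θ : ι → τ →₀ ℕ) (hf : ∀ t ∈ s, IsSupportedOnResidue q (θ t) (f t)) {m : τ →₀ ℕ}
    (hm : coeff m (∑ t ∈ s, f t) ≠ 0) : ∃ t ∈ s, f t ≠ 0 ∧ ∀ i, m i ≡ θ t i [MOD q] := by
  rw [map_sum] at hm
  obtain ⟨t, ht, ht0⟩ := Finset.exists_ne_zero_of_sum_ne_zero hm
  refine ⟨t, ht, fun h => ht0 (by rw [h, map_zero]), hf t ht m ht0⟩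

/-- The same for sums `Σ_{t ∈ s} u_t · X^{θ_t}` with `u_t ∈ A⟦X^q⟧`.
[cite: Matsumura1987, §30 proof of Thm. 30.9 p. 243 (q-adic monomial decomposition)] -/
theorem exists_modEq_of_coeff_sum_mul_monomial_ne_zero [DecidableEq τ] {q : ℕ} {ι : Type*} (s : Finset ι)
    (u : ι → MvPowerSeries τ A) (θ : ι → τ →₀ ℕ) (hu : ∀ t ∈ s, IsSupportedOnMultiples q (u t))
    {m : τ →₀ ℕ} (hm : coeff m (∑ t ∈ s, u t * monomial (θ t) 1) ≠ 0) :
    ∃ t ∈ s, u t ≠ 0 ∧ ∀ i, m i ≡ θ t i [MOD q] := by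
  obtain ⟨t, ht, ht0, hmod⟩ := exists_modEq_of_coeff_sum_ne_zero s (fun t => u t * monomial (θ t) 1) θ
    (fun t ht => (hu t ht).isSupportedOnResidue_mul_monomial (θ t) 1) hm
  exact ⟨t, ht, fun h => ht0 (by rw [h, zero_mul]), hmod⟩

/-- **Every effective term leaves a trace in its residue class.** Let `Φ = Σ_{t ∈ s} u_t · X^{θ_t}` with
`u_t ∈ A⟦X^q⟧`, the exponents `θ_t` pairwise distinct on `s`, and every non-zero `u_t` having a non-zero
constant coefficient (e.g. `u_t` zero or a unit). Then for every `t₀ ∈ s` with `u_{t₀} ≠ 0` the series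
`Φ` has a non-zero coefficient at some exponent congruent to `θ_{t₀}` mod `q` — namely at a `≤`-minimal
`θ_{t₁}` among the `θ_t ≡ θ_{t₀}` with `u_t ≠ 0`, where the coefficient is the constant coefficient of
`u_{t₁}`. [cite: Matsumura1987, §30 proof of Thm. 30.9 p. 243 (q-adic monomial decomposition)] -/
theorem exists_coeff_ne_zero_modEq_of_sum_mul_monomial [DecidableEq τ] {q : ℕ} {ι : Type*}
    (s : Finset ι) (u : ι → MvPowerSeries τ A) (θ : ι → τ →₀ ℕ)
    (hu : ∀ t ∈ s, IsSupportedOnMultiples q (u t))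
    (hu0 : ∀ t ∈ s, u t ≠ 0 → constantCoeff (u t) ≠ 0) (hθ : Set.InjOn θ s)
    {t₀ : ι} (ht₀ : t₀ ∈ s) (hut₀ : u t₀ ≠ 0) :
    ∃ m : τ →₀ ℕ, coeff m (∑ t ∈ s, u t * monomial (θ t) 1) ≠ 0 ∧ ∀ i, m i ≡ θ t₀ i [MOD q] := by
  classical
  -- the effective terms in the residue class of `θ t₀`
  set S : Finset ι := s.filter fun t => u t ≠ 0 ∧ ∀ i, θ t i ≡ θ t₀ i [MOD q] with hS
  have hS0 : S.Nonempty := ⟨t₀, by rw [hS, Finset.mem_filter]; exact ⟨ht₀, hut₀, fun i => Nat.ModEq.refl _⟩⟩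
  obtain ⟨t₁, ht₁⟩ := S.exists_minimalFor θ hS0
  have ht₁S : t₁ ∈ S := ht₁.prop
  rw [hS, Finset.mem_filter] at ht₁S
  obtain ⟨ht₁s, hut₁, hres₁⟩ := ht₁S
  refine ⟨θ t₁, ?_, hres₁⟩
  rw [map_sum, Finset.sum_eq_single t₁]
  · -- the term `t₁` contributes the constant coefficient of `u t₁`
    rw [coeff_mul_monomial, if_pos le_rfl, tsub_self, mul_one, coeff_zero_eq_constantCoeff_apply]
    exact hu0 t₁ ht₁s hut₁
  · -- every other term has coefficient `0` at `θ t₁`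
    intro t ht hne
    rw [coeff_mul_monomial, mul_one]
    split_ifs with hle
    · by_cases hut : u t = 0
      · rw [hut, map_zero]
      · -- `u t ≠ 0` and `θ t ≤ θ t₁`: either a different residue class (coefficient of `u t` off the
        -- lattice) or the same class, where minimality forces `θ t = θ t₁`, contradicting injectivity
        by_cases hcls : ∀ i, θ t i ≡ θ t₀ i [MOD q]
        · have htS : t ∈ S := by rw [hS, Finset.mem_filter]; exact ⟨ht, hut, hcls⟩
          have hge : θ t₁ ≤ θ t := ht₁.2 htS hle
          exact absurd (hθ ht ht₁s (le_antisymm hle hge)) hne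
        · push Not at hcls
          obtain ⟨i, hi⟩ := hcls
          refine hu t ht _ ⟨i, fun hdvd => hi ?_⟩
          -- `q ∣ (θ t₁ - θ t) i` with `θ t ≤ θ t₁` and `θ t₁ i ≡ θ t₀ i` gives `θ t i ≡ θ t₀ i`
          have h1 : (θ t₁ - θ t) i + θ t i = θ t₁ i := by
            rw [Finsupp.tsub_apply, tsub_add_cancel_of_le (hle i)]
          have h2 : θ t i ≡ θ t₁ i [MOD q] := by
            have := (Nat.modEq_zero_iff_dvd.mpr hdvd).add (Nat.ModEq.refl (θ t i))
            rw [zero_add, h1] at this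
            exact this.symm
          exact h2.trans (hres₁ i)
    · rfl
  · intro h
    exact absurd ht₁s h

/-! ## Divided derivatives and residue classes -/

/-- `Δ_K` shifts residue classes by `−K`: if `f` is supported on the class of `r` and `r′ + K ≡ r`, then
`Δ_K f` is supported on the class of `r′` (its coefficient at `β` is a multiple of `f_{K+β}`).
[cite: Abad2019pBases, §6 p.13 (Tay^β(X^α) = binom(α,β) X^{α−β})] -/
theorem IsSupportedOnResidue.hasseDeriv_shift {q : ℕ} {r r' : τ →₀ ℕ} {f : MvPowerSeries τ A}
    (hf : IsSupportedOnResidue q r f) (K : τ →₀ ℕ) (hK : ∀ s, r' s + K s ≡ r s [MOD q]) :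
    IsSupportedOnResidue q r' (hasseDeriv K f) := by
  intro β hβ s
  rw [coeff_hasseDeriv] at hβ
  have h := hf (K + β) (right_ne_zero_of_mul hβ) s
  rw [Finsupp.add_apply, add_comm] at h
  exact Nat.ModEq.add_right_cancel' (K s) (h.trans (hK s).symm)

/-- In particular `Δ_B` PRESERVES residue classes when `q ∣ B`.
[cite: Abad2019pBases, §6 p.13 (Tay^β(X^α) = binom(α,β) X^{α−β})] -/
theorem IsSupportedOnResidue.hasseDeriv_of_dvd {q : ℕ} {r : τ →₀ ℕ} {f : MvPowerSeries τ A}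
    (hf : IsSupportedOnResidue q r f) {B : τ →₀ ℕ} (hB : ∀ s, q ∣ B s) :
    IsSupportedOnResidue q r (hasseDeriv B f) :=
  hf.hasseDeriv_shift B fun s => by
    have := (Nat.ModEq.refl (r s)).add (Nat.modEq_zero_iff_dvd.mpr (hB s))
    rwa [add_zero] at this

section Frobenius

variable (p : ℕ) [hp : Fact p.Prime] [CharP A p] [Fintype τ]

/-- **Coefficients of `Δ_K` on one residue class** (`q = p^e`, `r_s, K_s < q`): if `f` is supported on the
residue class of `r`, then `coeff_β (Δ_K f) = (∏_s C(r_s, K_s)) · f_{K+β}` — by Lucas periodicity the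
binomial `C((K+β)_s, K_s)` only depends on `(K+β)_s mod q = r_s` wherever `f_{K+β} ≠ 0`.
[cite: Abad2019pBases, Lemma 6.2 (arithmetic behind p^e-linearity; Lucas)] -/
theorem coeff_hasseDeriv_of_isSupportedOnResidue {e : ℕ} {r K : τ →₀ ℕ} {f : MvPowerSeries τ A}
    (hf : IsSupportedOnResidue (p ^ e) r f) (hr : ∀ s, r s < p ^ e) (hK : ∀ s, K s < p ^ e)
    (β : τ →₀ ℕ) :
    coeff β (hasseDeriv K f) = ((∏ s, (r s).choose (K s) : ℕ) : A) * coeff (K + β) f := by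
  rw [coeff_hasseDeriv, prod_choose_eq]
  by_cases h0 : coeff (K + β) f = 0
  · rw [h0, mul_zero, mul_zero]
  · congr 1
    have hres := hf _ h0
    rw [Nat.cast_prod, Nat.cast_prod]
    refine Finset.prod_congr rfl fun s _ => ?_
    have h1 : (K s + β s) % p ^ e = r s := by
      have := hres s
      rw [Finsupp.add_apply] at this
      rw [this, Nat.mod_eq_of_lt (hr s)]
    have h2 : K s + β s = r s + p ^ e * ((K s + β s) / p ^ e) := by
      have := Nat.mod_add_div (K s + β s) (p ^ e)
      rw [h1] at this
      exact this.symm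
    rw [h2]
    exact natCast_choose_add_eq_of_dvd p (hK s) (dvd_mul_right _ _)

/-- **Vanishing**: under the same hypotheses, if the multi-index binomial `∏_s C(r_s, K_s)` is `0` in `A`
then `Δ_K f = 0`. [cite: Abad2019pBases, Lemma 6.2 (arithmetic behind p^e-linearity; Lucas)] -/
theorem hasseDeriv_eq_zero_of_isSupportedOnResidue {e : ℕ} {r K : τ →₀ ℕ} {f : MvPowerSeries τ A}
    (hf : IsSupportedOnResidue (p ^ e) r f) (hr : ∀ s, r s < p ^ e) (hK : ∀ s, K s < p ^ e)
    (h0 : ((∏ s, (r s).choose (K s) : ℕ) : A) = 0) : hasseDeriv K f = 0 := by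
  ext β
  rw [coeff_hasseDeriv_of_isSupportedOnResidue p hf hr hK, h0, zero_mul, map_zero]

/-- **Shift**: on the residue class of `K` itself (`K_s < q`), `Δ_K` is the plain shift
`coeff_β (Δ_K f) = f_{K+β}`. [cite: Abad2019pBases, Lemma 6.2 (arithmetic behind p^e-linearity; Lucas)] -/
theorem coeff_hasseDeriv_of_isSupportedOnResidue_self {e : ℕ} {K : τ →₀ ℕ} {f : MvPowerSeries τ A}
    (hf : IsSupportedOnResidue (p ^ e) K f) (hK : ∀ s, K s < p ^ e) (β : τ →₀ ℕ) :
    coeff β (hasseDeriv K f) = coeff (K + β) f := by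
  rw [coeff_hasseDeriv_of_isSupportedOnResidue p hf hK hK, Finset.prod_congr rfl fun s _ =>
    Nat.choose_self (K s), Finset.prod_const_one, Nat.cast_one, one_mul]

/-- **Two-level digits, vanishing of `Δ_{α+pβ}`**: let `f` be supported on the residue class of
`a + p·b` modulo `q = p^e` with digits `a_s, α_s < p` and `a_s + p b_s, α_s + p β_s < q`. If NOT
(`α ≤ a` and `β ≤ b`) then `Δ_{α + p·β} f = 0`. [cite: Abad2019pBases, Lemma 6.2 (arithmetic behind p^e-linearity; Lucas)] -/
theorem hasseDeriv_digit_eq_zero_of_isSupportedOnResidue {e : ℕ} {a b α β : τ →₀ ℕ}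
    {f : MvPowerSeries τ A} (hf : IsSupportedOnResidue (p ^ e) (a + p • b) f)
    (ha : ∀ s, a s < p) (hα : ∀ s, α s < p) (hab : ∀ s, a s + p * b s < p ^ e)
    (hαβ : ∀ s, α s + p * β s < p ^ e) (h : ¬ (α ≤ a ∧ β ≤ b)) :
    hasseDeriv (α + p • β) f = 0 := by
  have hr : ∀ s, (a + p • b) s < p ^ e := fun s => by
    simpa [Finsupp.add_apply, Finsupp.smul_apply, smul_eq_mul] using hab s
  have hK : ∀ s, (α + p • β) s < p ^ e := fun s => by
    simpa [Finsupp.add_apply, Finsupp.smul_apply, smul_eq_mul] using hαβ s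
  refine hasseDeriv_eq_zero_of_isSupportedOnResidue p hf hr hK ?_
  have := natCast_prod_choose_digit_eq_zero (A := A) p ha hα h
  simpa [Finsupp.add_apply, Finsupp.smul_apply, smul_eq_mul] using this

/-- **Two-level digits, the diagonal shift**: on the residue class of `a + p·b` (`a_s < p`,
`a_s + p b_s < q = p^e`), `Δ_{a + p·b}` is the shift: `coeff_β (Δ_{a+pb} f) = f_{a + pb + β}`.
[cite: Abad2019pBases, Lemma 6.2 (arithmetic behind p^e-linearity; Lucas)] -/
theorem coeff_hasseDeriv_digit_self {e : ℕ} {a b : τ →₀ ℕ} {f : MvPowerSeries τ A}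
    (hf : IsSupportedOnResidue (p ^ e) (a + p • b) f) (hab : ∀ s, a s + p * b s < p ^ e)
    (β : τ →₀ ℕ) : coeff β (hasseDeriv (a + p • b) f) = coeff (a + p • b + β) f :=
  coeff_hasseDeriv_of_isSupportedOnResidue_self p hf (fun s => by
    simpa [Finsupp.add_apply, Finsupp.smul_apply, smul_eq_mul] using hab s) β

end Frobenius

end Literature.RingTheory.MvPowerSeries

end
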